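import Summits.Parity.GeneralizedHardyLittlewood.Theorems.LiouvilleMADEngineToGHLPairsReach

/-!
# Crux `EngineToGHL` (stmt-Parity-14995, route LiouvilleMAD), line `tuple_ladder` (cycle 2), stub `stub_tuplesReach`

Crux `Summit.Parity.GeneralizedHardyLittlewood.Theses.LiouvilleMAD.EngineToGHL`, line `tuple_ladder`,
cycle 2 (the reach of the prime-tuples conjecture inside Green–Tao's `DimOne`): the ASSEMBLY step.

For `t ≥ 2`, a bound `Hb` on the shift differences, a size bound `L` and `ε > 0`, assume

* (D) the dictionary: for a unit-slope system `ψᵢ(n) = n + bᵢ` (`Ψ : Fin t → AffLinForm 1`, all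
  coefficients `1`) with distinct shifts and minimal shift `c`, the weighted prime-point sum (1.2) over
  `K ⊆ [-N, N]` is the block sum `∑_{m ∈ T} ∏_{h ∈ H} Λ((m + c) + h)` over the integer points
  `T = {m ∈ [-N, N] ∩ J : -c < m}` of the section `J` of `K` (`H = {bᵢ - c} ⊆ ℕ`), and the
  archimedean factor is `β_∞ = vol(J ∩ (-c, ∞))`;
* (S) the singular product of such a system is the Hardy–Littlewood singular series of (any translate
  of) its shift set, `∏_p β_p = 𝔖({bᵢ - c})`;
* (U) the uniform Hardy–Littlewood bound `|∑_{n ≤ M} ∏_{h ∈ H} Λ(n + h) - 𝔖(H) M| ≤ δ M + C` for all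
  `M` and all tuples `H ∋ 0`, `#H ≥ 2`, `H ⊆ [0, Hb]`.

Then eventually in `N`, for every non-degenerate unit-slope `Ψ : Fin t → AffLinForm 1` with
`‖Ψ‖_N ≤ L`, `|bᵢ - bⱼ| ≤ Hb`, and every convex `K ⊆ [-N, N]`:
`|∑_{n ∈ K ∩ ℤ} ∏ᵢ Λ(ψᵢ(n)) - β_∞ ∏_p β_p| ≤ ε N`.

Proof (the `t = 2` model is `EngineToGHL.pairsReach_of_pairsHL`): `c = min bᵢ` (`|c| ≤ L N`),
`H = {bᵢ - c} ∋ 0` (`#H = t`, `H ⊆ [0, Hb]`); the section `J' = J ∩ (-c, ∞)` is an interval in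
`[-N, N]`, its integer points a block `p, …, q` (or empty), the block sum is `S_H(q + c) - S_H(p + c - 1)`
with both ends `≤ (L+1) N` (`sum_Icc_toNat_shift_eq`), the number of integer points is within `1` of
`vol(J')` (`abs_card_filter_sub_volume_le_one`), and the two `(U)`-bounds plus `|𝔖(H)| ≤ 𝔖s` are
combined by `block_arith` with `δ = ε / (4(L+2))`, `2C + 𝔖s ≤ ε N / 2`.

References: B. Green, T. Tao, *Linear equations in primes*, Ann. of Math. 171 (2010), Conj. 1.2,
(1.1)–(1.7) [GreenTao2010]; G. H. Hardy, J. E. Littlewood, Acta Math. 44 (1923) [HardyLittlewood1923].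
-/

noncomputable section

namespace Summit.Parity.GeneralizedHardyLittlewood.Theorems.EngineToGHL.TupleLadder

open Finset Filter MeasureTheory Literature.NumberTheory.Sieve
open scoped ArithmeticFunction.vonMangoldt Topology Classical
open Summit.Parity.GeneralizedHardyLittlewood.Cruxes.RelativeDimOne.TranslateAmplification
  (ordConnected_section section_subset_Icc)

/-! ### Block sums as differences of partial sums -/

/-- Partial-sum form of a block sum of `f((m + c)⁺)` over `m = p, …, q` with `p ≤ q`, `p + c ≥ 1`:
`∑_{m=p}^{q} f(m + c) = F(q + c) - F(p + c - 1)` with `F(M) = ∑_{1 ≤ n ≤ M} f(n)`. [folklore] -/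
theorem sum_Icc_toNat_shift_eq (f : ℕ → ℝ) {p q c : ℤ} (hpq : p ≤ q) (hpc : 1 ≤ p + c) :
    ∑ m ∈ Finset.Icc p q, f ((m + c).toNat) =
      ∑ n ∈ Finset.Icc 1 (q + c).toNat, f n - ∑ n ∈ Finset.Icc 1 ((p + c).toNat - 1), f n := by
  -- adapted from `EngineToGHL.sum_Icc_shift_eq` (the pair-specific version)
  have h1 : ∑ m ∈ Finset.Icc p q, f ((m + c).toNat) =
      ∑ n ∈ Finset.Icc (p + c).toNat (q + c).toNat, f n := by
    refine Finset.sum_nbij' (fun m => (m + c).toNat) (fun n => (n : ℤ) - c) ?_ ?_ ?_ ?_ ?_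
    · intro m hm
      rw [Finset.mem_Icc] at hm ⊢
      omega
    · intro n hn
      rw [Finset.mem_Icc] at hn ⊢
      omega
    · intro m hm
      rw [Finset.mem_Icc] at hm
      omega
    · intro n hn
      rw [Finset.mem_Icc] at hn
      omega
    · intro m _
      rfl
  rw [h1, eq_sub_iff_add_eq, add_comm]
  have hsplit : Finset.Icc 1 (q + c).toNat =
      Finset.Icc 1 ((p + c).toNat - 1) ∪ Finset.Icc (p + c).toNat (q + c).toNat := by
    ext n
    simp only [Finset.mem_union, Finset.mem_Icc]
    omega
  rw [hsplit, Finset.sum_union]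
  rw [Finset.disjoint_left]
  intro n hn hn'
  simp only [Finset.mem_Icc] at hn hn'
  omega

/-! ### The assembly -/

/-- **The reach of the prime-tuples conjecture inside `DimOne`, assembled.** From the dictionary (D),
the singular-product identity (S) and the uniform Hardy–Littlewood bound (U): for `t ≥ 2`, eventually in
`N`, every non-degenerate unit-slope system `ψᵢ(n) = n + bᵢ` (`i < t`) with `‖Ψ‖_N ≤ L` and
`|bᵢ - bⱼ| ≤ Hb` satisfies the Green–Tao asymptotic `|∑_{n ∈ K ∩ ℤ} ∏ᵢ Λ(ψᵢ(n)) - β_∞ ∏_p β_p| ≤ ε N`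
over every convex `K ⊆ [-N, N]`: with `c = min bᵢ`, `H = {bᵢ - c}`, the block of integer points
`p, …, q` of the section of `K` above `-c` gives the difference `S_H(q + c) - S_H(p + c - 1)` of two
partial sums with ends `≤ (L+1) N`, the lattice count is within `1` of `β_∞`, and `∏_p β_p = 𝔖(H)`.
[cite: GreenTao2010, Conj. 1.2, (1.2), (1.4), (1.7)] -/
theorem stub_tuplesReach :
    ∀ (t Hb L : ℕ) (ε : ℝ), 2 ≤ t → 0 < ε → (∀ (t : ℕ) (Ψ : Fin t → Literature.NumberTheory.Sieve.AffLinForm 1), (∀ i j, (Ψ i).coeff j = 1) → Function.Injective (fun i => (Ψ i).const) → ∀ c : ℤ, (∀ i, c ≤ (Ψ i).const) → (∃ i, (Ψ i).const = c) → ∀ (K : Set (Fin 1 → ℝ)) (J : Set ℝ), (∀ y : ℝ, y ∈ J ↔ (fun _ : Fin 1 => y) ∈ K) → ∀ (N : ℕ) (T : Finset ℤ), (∀ m : ℤ, m ∈ T ↔ (m ∈ Finset.Icc (-(N : ℤ)) N ∧ (m : ℝ) ∈ J ∧ -c < m)) → Literature.NumberTheory.Sieve.vonMangoldtSum Ψ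 K N = (∑ m ∈ T, ∏ h ∈ Finset.univ.image (fun i => ((Ψ i).const - c).toNat), ArithmeticFunction.vonMangoldt ((m + c).toNat + h)) ∧ Literature.NumberTheory.Sieve.archFactor Ψ K = (MeasureTheory.volume (J ∩ Set.Ioi (-(c : ℝ)))).toReal) → (∀ (t : ℕ) (Ψ : Fin t → Literature.NumberTheory.Sieve.AffLinForm 1), (∀ i j, (Ψ i).coeff j = 1) → Function.Injective (fun i => (Ψ i).const) → ∀ c : ℤ, Literature.NumberTheory.Sieve.singularProduct Ψ = Literature.NumberTheory.Sieve.singularSeries (Finset.univ.image (fun i => (Ψ i).const - c))) → (∀ (Hb : ℕ) (δ : ℝ), 0 < δ → ∃ C : ℝ, 0 ≤ C ∧ ∀ H : Finset ℕ, 0 ∈ H → 2 ≤ H.card → (∀ h ∈ H, h ≤ Hb) → ∀ M : ℕ, |∑ n ∈ Finset.Icc 1 M, ∏ h ∈ H, ArithmeticFunction.vonMangoldt (n + h) - Literature.NumberTheory.Sieve.singularSeries ((H).image (fun h : ℕ => (h : ℤ))) * M| ≤ δ * M + C) → ∃ N₀ : ℕ, ∀ N : ℕ, N₀ ≤ N →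 ∀ Ψ : Fin t → Literature.NumberTheory.Sieve.AffLinForm 1, Literature.NumberTheory.Sieve.IsNondegenerateSystem Ψ → Literature.NumberTheory.Sieve.affLinSize Ψ N ≤ L → (∀ i j, (Ψ i).coeff j = 1) → (∀ i j, |(Ψ i).const - (Ψ j).const| ≤ (Hb : ℤ)) → ∀ K : Set (Fin 1 → ℝ), Convex ℝ K → K ⊆ Literature.NumberTheory.Sieve.realBox 1 N → |Literature.NumberTheory.Sieve.vonMangoldtSum Ψ K N - Literature.NumberTheory.Sieve.archFactor Ψ K * Literature.NumberTheory.Sieve.singularProduct Ψ| ≤ ε * (N : ℝ) := by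
  intro t Hb L ε ht hε hD hS hU
  -- (0) uniform constants: `𝔖s` bounds every `𝔖(H)`, `H ⊆ [0, Hb]`; `C` is the `(U)` constant at `δ`
  obtain ⟨𝔖s, h𝔖s⟩ : ∃ S : ℝ, ∑ H ∈ (Finset.range (Hb + 1)).powerset,
      |singularSeries (H.image (fun h : ℕ => (h : ℤ)))| = S := ⟨_, rfl⟩
  have h𝔖s0 : 0 ≤ 𝔖s := by rw [← h𝔖s]; exact Finset.sum_nonneg fun _ _ => abs_nonneg _
  have hL2 : (0 : ℝ) < (L : ℝ) + 2 := by positivity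
  obtain ⟨δ, hδ⟩ : ∃ δ : ℝ, ε / (4 * ((L : ℝ) + 2)) = δ := ⟨_, rfl⟩
  have hδ0 : 0 < δ := by rw [← hδ]; positivity
  obtain ⟨C, hC0, hC⟩ := hU Hb δ hδ0
  refine ⟨⌈(2 * C + 𝔖s) * (2 / ε)⌉₊ + 1, fun N hN Ψ hnd hL hcoeff hHb K hK hKN => ?_⟩
  have hN1 : 1 ≤ N := le_trans (Nat.le_add_left 1 _) hN
  have hNpos : (0 : ℝ) < N := by exact_mod_cast hN1
  have hNC : 2 * C + 𝔖s ≤ ε / 2 * N := by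
    have h1 : (2 * C + 𝔖s) * (2 / ε) ≤ ⌈(2 * C + 𝔖s) * (2 / ε)⌉₊ := Nat.le_ceil _
    have h2 : (⌈(2 * C + 𝔖s) * (2 / ε)⌉₊ : ℝ) + 1 ≤ N := by exact_mod_cast hN
    have h3 : (2 * C + 𝔖s) * (2 / ε) * (ε / 2) ≤ N * (ε / 2) :=
      mul_le_mul_of_nonneg_right (by linarith) (le_of_lt (half_pos hε))
    have h4 : (2 * C + 𝔖s) * (2 / ε) * (ε / 2) = 2 * C + 𝔖s := by
      field_simp
    linarith only [h1, h2, h3, h4]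
  -- (1) the shifts `bᵢ = (Ψ i).const`: distinct (non-degeneracy), minimum `c` attained at `i₀`
  have hinj : Function.Injective (fun i => (Ψ i).const) := by
    intro i j hij
    have hij' : (Ψ i).const = (Ψ j).const := hij
    by_contra hne
    have h := hnd.2 i j hne 1 1 (fun n => by
      rw [eval_unitSlope (hcoeff i), eval_unitSlope (hcoeff j), hij'])
    exact one_ne_zero h.1
  have hune : (Finset.univ : Finset (Fin t)).Nonempty := ⟨⟨0, by omega⟩, Finset.mem_univ _⟩
  have himne : (Finset.univ.image (fun i => (Ψ i).const)).Nonempty := hune.image _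
  obtain ⟨c, hc⟩ : ∃ c : ℤ, (Finset.univ.image (fun i => (Ψ i).const)).min' himne = c := ⟨_, rfl⟩
  have hcle : ∀ i, c ≤ (Ψ i).const := fun i => by
    rw [← hc]
    exact Finset.min'_le _ _ (Finset.mem_image_of_mem (fun i => (Ψ i).const) (Finset.mem_univ i))
  obtain ⟨i₀, hi₀⟩ : ∃ i, (Ψ i).const = c := by
    have hmem := Finset.min'_mem _ himne
    rw [hc, Finset.mem_image] at hmem
    obtain ⟨i, _, hi⟩ := hmem
    exact ⟨i, hi⟩
  -- size: `|c| ≤ L N`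
  have hcLN : |(c : ℝ)| ≤ L * N := by
    have h0 := abs_const_le_of_affLinSize_le hN1 hL i₀
    rw [hi₀] at h0
    exact h0
  -- the tuple `H = {bᵢ - c} ∋ 0`, `#H = t ≥ 2`, `H ⊆ [0, Hb]`, `H = {bᵢ - c}` as integers
  obtain ⟨H, hHdef⟩ : ∃ H : Finset ℕ,
      Finset.univ.image (fun i => ((Ψ i).const - c).toNat) = H := ⟨_, rfl⟩
  have hHmem : ∀ h, h ∈ H ↔ ∃ i, ((Ψ i).const - c).toNat = h := fun h => by
    rw [← hHdef]
    simp only [Finset.mem_image, Finset.mem_univ, true_and]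
  have h0H : 0 ∈ H := (hHmem 0).mpr ⟨i₀, by rw [hi₀, sub_self]; rfl⟩
  have hHcard : H.card = t := by
    rw [← hHdef, Finset.card_image_of_injective _ ?_, Finset.card_univ, Fintype.card_fin]
    intro i j hij
    have hij' : ((Ψ i).const - c).toNat = ((Ψ j).const - c).toNat := hij
    have hi := hcle i
    have hj := hcle j
    apply hinj
    show (Ψ i).const = (Ψ j).const
    omega
  have h2H : 2 ≤ H.card := by rw [hHcard]; exact ht
  have hHb' : ∀ h ∈ H, h ≤ Hb := by
    intro h hh
    obtain ⟨i, rfl⟩ := (hHmem h).mp hh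
    have h1 := hHb i i₀
    rw [hi₀] at h1
    have h2 := le_abs_self ((Ψ i).const - c)
    have h3 : (Ψ i).const - c ≤ Hb := h2.trans h1
    omega
  have hHcast : H.image (fun h : ℕ => (h : ℤ)) = Finset.univ.image (fun i => (Ψ i).const - c) := by
    rw [← hHdef, Finset.image_image]
    refine Finset.image_congr fun i _ => ?_
    simp only [Function.comp_apply]
    exact Int.toNat_of_nonneg (sub_nonneg.mpr (hcle i))
  -- (S): `∏_p β_p = 𝔖(H)`
  have hsing : singularProduct Ψ = singularSeries (H.image (fun h : ℕ => (h : ℤ))) := by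
    rw [hHcast]
    exact hS t Ψ hcoeff hinj c
  -- (2) the section `J` of `K` and its positive part `J' = J ∩ (-c, ∞)`
  obtain ⟨J, hJdef⟩ : ∃ J : Set ℝ, {y : ℝ | (fun _ : Fin 1 => y) ∈ K} = J := ⟨_, rfl⟩
  have hJmem : ∀ y : ℝ, y ∈ J ↔ (fun _ : Fin 1 => y) ∈ K := fun y => by rw [← hJdef]; rfl
  have hJ : J.OrdConnected := by rw [← hJdef]; exact ordConnected_section hK
  have hJN : J ⊆ Set.Icc (-(N : ℝ)) N := by rw [← hJdef]; exact section_subset_Icc hKN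
  obtain ⟨J', hJ'def⟩ : ∃ J' : Set ℝ, J ∩ Set.Ioi (-(c : ℝ)) = J' := ⟨_, rfl⟩
  have hJ' : J'.OrdConnected := by rw [← hJ'def]; exact hJ.inter Set.ordConnected_Ioi
  have hJ'N : J' ⊆ Set.Icc (-(N : ℝ)) N := by rw [← hJ'def]; exact fun y hy => hJN hy.1
  have hJ'mem : ∀ y : ℝ, y ∈ J' ↔ y ∈ J ∧ -(c : ℝ) < y := fun y => by rw [← hJ'def]; rfl
  -- the integer points `T` of `J'` in `[-N, N]`, as described extensionally in (D)
  have hT : ∀ m : ℤ, m ∈ (Finset.Icc (-(N : ℤ)) N).filter (fun m : ℤ => (m : ℝ) ∈ J') ↔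
      (m ∈ Finset.Icc (-(N : ℤ)) N ∧ (m : ℝ) ∈ J ∧ -c < m) := by
    intro m
    rw [Finset.mem_filter, hJ'mem]
    constructor
    · rintro ⟨h1, h2, h3⟩
      exact ⟨h1, h2, by exact_mod_cast h3⟩
    · rintro ⟨h1, h2, h3⟩
      exact ⟨h1, h2, by exact_mod_cast h3⟩
  -- (D): Step 1 (the weighted sum is the block sum) and Step 2 (`β_∞ = vol(J')`)
  obtain ⟨hsum, harch⟩ := hD t Ψ hcoeff hinj c hcle ⟨i₀, hi₀⟩ K J hJmem N _ hT
  rw [hHdef] at hsum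
  rw [hJ'def] at harch
  rw [hsum, harch, hsing]
  have hvolT := abs_card_filter_sub_volume_le_one hJ' hJ'N
  have h𝔖le : |singularSeries (H.image (fun h : ℕ => (h : ℤ)))| ≤ 𝔖s := by
    rw [← h𝔖s]
    refine Finset.single_le_sum
      (f := fun H' : Finset ℕ => |singularSeries (H'.image (fun h : ℕ => (h : ℤ)))|)
      (fun _ _ => abs_nonneg _) ?_
    rw [Finset.mem_powerset]
    intro h hh
    rw [Finset.mem_range]
    exact Nat.lt_succ_of_le (hHb' h hh)
  -- (3) empty block, or a block `p, …, q` with `p + c ≥ 1`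
  rcases ((Finset.Icc (-(N : ℤ)) N).filter
      (fun m : ℤ => (m : ℝ) ∈ J')).eq_empty_or_nonempty with hTe | hTne
  · rw [hTe, Finset.sum_empty, zero_sub, abs_neg, abs_mul]
    rw [hTe, Finset.card_empty, Nat.cast_zero, zero_sub, abs_neg] at hvolT
    have hεN : 0 < ε * N := mul_pos hε hNpos
    calc |(volume J').toReal| * |singularSeries (H.image (fun h : ℕ => (h : ℤ)))|
        ≤ 1 * 𝔖s := mul_le_mul hvolT h𝔖le (abs_nonneg _) zero_le_one
      _ = 𝔖s := one_mul _
      _ ≤ ε * N := by linarith only [hNC, hC0, hεN]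
  · -- the block
    have hTpq := filter_Icc_mem_eq_Icc hJ' hTne
    obtain ⟨p, hp⟩ : ∃ p : ℤ, ((Finset.Icc (-(N : ℤ)) N).filter
        (fun m : ℤ => (m : ℝ) ∈ J')).min' hTne = p := ⟨_, rfl⟩
    obtain ⟨q, hq⟩ : ∃ q : ℤ, ((Finset.Icc (-(N : ℤ)) N).filter
        (fun m : ℤ => (m : ℝ) ∈ J')).max' hTne = q := ⟨_, rfl⟩
    have hpT := Finset.min'_mem _ hTne
    have hqT := Finset.max'_mem _ hTne
    rw [hp] at hpT
    rw [hq] at hqT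
    have hpq : p ≤ q := by rw [← hp]; exact Finset.min'_le _ q hqT
    have hp' := Finset.mem_filter.mp hpT
    have hq' := Finset.mem_filter.mp hqT
    have hpc : 1 ≤ p + c := by
      have h1 : -(c : ℝ) < p := ((hJ'mem _).mp hp'.2).2
      have h2 : -c < p := by exact_mod_cast h1
      omega
    have hqN : q ≤ N := (Finset.mem_Icc.mp hq'.1).2
    rw [hp, hq] at hTpq
    have hshift := sum_Icc_toNat_shift_eq (fun n : ℕ => ∏ h ∈ H, Λ (n + h)) hpq hpc
    rw [hTpq, hshift]
    rw [hTpq, Int.card_Icc] at hvolT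
    -- the two ends `A ≤ B ≤ (L+1) N` of the block, in `ℝ`
    obtain ⟨B, hB⟩ : ∃ B : ℕ, (q + c).toNat = B := ⟨_, rfl⟩
    obtain ⟨A, hA⟩ : ∃ A : ℕ, (p + c).toNat - 1 = A := ⟨_, rfl⟩
    rw [hB, hA]
    have hBr : (B : ℝ) = q + c := by
      have : (B : ℤ) = q + c := by rw [← hB]; exact Int.toNat_of_nonneg (by omega)
      exact_mod_cast this
    have hAr : (A : ℝ) = p + c - 1 := by
      have : (A : ℤ) = p + c - 1 := by rw [← hA]; omega
      exact_mod_cast this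
    have hcardr : (((q + 1 - p).toNat : ℕ) : ℝ) = q + 1 - p := by
      have : (((q + 1 - p).toNat : ℕ) : ℤ) = q + 1 - p := Int.toNat_of_nonneg (by omega)
      exact_mod_cast this
    rw [hcardr] at hvolT
    have hcabs := abs_le.mp hcLN
    have hqr : (q : ℝ) ≤ N := by exact_mod_cast hqN
    have hpqr : (p : ℝ) ≤ q := by exact_mod_cast hpq
    have hLN : ((L : ℝ) + 1) * N = L * N + N := by ring
    have hBle : (B : ℝ) ≤ ((L : ℝ) + 1) * N := by
      rw [hBr, hLN]
      linarith only [hcabs.2, hqr]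
    have hAB : (A : ℝ) ≤ B := by
      rw [hAr, hBr]
      linarith only [hpqr]
    exact block_arith (hC H h0H h2H hHb' B) (hC H h0H h2H hHb' A) h𝔖le hvolT (by rw [hBr, hAr]; ring)
      hAB hBle hNC hδ hε hNpos (Nat.cast_nonneg L) h𝔖s0

end Summit.Parity.GeneralizedHardyLittlewood.Theorems.EngineToGHL.TupleLadder

end
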